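import Literature.NumberTheory.Automorphic.Liu2021.Def45RMuForm
import Literature.AlgebraicGeometry.Milne1999.CentraliserFixesDivisorClasses
import Literature.AlgebraicGeometry.Motives.HodgeDecompositionHardLefschetzDischarge
import Literature.AlgebraicGeometry.Motives.RationalDegreeOneModel
import Literature.AlgebraicGeometry.HodgeTheory.HodgeRiemannPolarizabilityProofs
import Literature.AlgebraicGeometry.HodgeTheory.WeilTypeRationalDatum
import HarnessLib

/-!
# [Liu 2021] Definition 4.5 (2), fourth bullet — the REAL typing `IsRMuNormalisable` is NOT VACUOUS: the Betti orbit is admissible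

(Object of THIS file: non-vacuity of the ORBIT PREDICATE `Def45.IsRMuNormalisable` of `Liu2021/Def45RMuForm` inside
`H¹(A_ℂ(ℂ); ℂ)`.  DISTINCT from hcmisog-isog-2's `Liu2021/Def45RMuExistsNonVacuity` — non-vacuity of the ENGINE's abstract de
Rham datum `(H, e, B)` — and from `Liu2021/LemD1AsPrintedNonVacuity` (App. D Lemma D.1, another stem).)

Y. Liu, *Fourier–Jacobi cycles and arithmetic relative trace formula*, Camb. J. Math. **9** (2021) = arXiv:2102.11518
[Liu2021]; TeX source `FJcycle.tex` (md5 `6db49a74122d…`), §4.1, Definition 4.5 (2) fourth bullet (l. 1957).  Companion of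
`Liu2021/Def45RMuForm` (pub-hodgecm2 pin-2; sub-row (CP-S4c-P) r-half of `HOME/pinning/HCMISOG-TABLE.md`; red-team WATCH W1).

`Def45.IsRMuNormalisable τ₀ A i θ₂` asks the printed `r_μ`-normalisation on EVERY admissible orbit `(w₀, c₀)` of
`H¹(A_ℂ(ℂ); ℂ)` — (R) the polarisation pairing is `k`-valued on the `k ⊗ K`-orbit of `w₀` through `c₀`, (P) it is
perfect there.  A vacuity audit (T1-style) must ask: is there ANY admissible orbit?  THIS FILE PROVES THERE IS, at every
CM pair: for `A/k` (`k ⊆ ℂ` a number field), `i : K → End⁰(A)` with `[K : ℚ] = 2 dim A`, and ANY class `θ₂` satisfying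
bullet 3 (`IsPolarisationClass`, of which only (a) rationality and (b) the Kähler multiple are used), the BETTI orbit is
admissible: `w₀ := v₀ ⊗ 1` for a non-zero RATIONAL class `v₀ ∈ H¹(A_ℂ(ℂ); ℚ)` (then `K · v₀ = H¹(A_ℂ(ℂ); ℚ)`: the orbit map
of the field `K` is injective, and `dim_ℚ H¹ = 2 dim A = [K : ℚ]`, [Shimura1998] §5.1 Prop. 3 / tree
`finrank_bettiCohomology_one`), `c₀ := ` the coordinate functional along a non-zero rational generator of the line
`H^{2 dim}(A_ℂ(ℂ); ℂ)` (`lineCoord`).  Then (R): `Q_{θ₂}` of rational classes is rational (`isRationalClass_polarizationPairingOne`)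
and rational classes have rational line coordinates, so the Gram values lie in `ℚ ⊆ σ(k)`; (P): a vector of the orbit
pairing to zero with the orbit pairs to zero with its `ℂ`-span `= H¹(A_ℂ(ℂ); ℂ)` (`β : H¹_ℚ ⊗ ℂ ≅ H¹_ℂ`), hence vanishes by
hard Lefschetz + Poincaré duality (`eq_zero_of_forall_polarizationPairingOne_eq_zero_of_hasHardLefschetzProperty`, the Kähler
multiple of bullet 3 (b)), and the orbit map `k ⊗ K → H¹_ℂ` is injective (`β` maps the `ℂ`-basis `1 ⊗ (b_j · v₀)` to the
orbit of the `ℚ`-basis `b_j` of `K`).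

* §1 `Def45.exists_admissible_orbit` — the admissible Betti orbit `(w₀, c₀)` with (R) and (P).
* §2 `Def45.IsRMuNormalisable.exists_normalised` — hence the predicate has CONTENT: given `IsRMuNormalisable τ₀ A i θ₂`, a
  conjugation `ρ` along `τ₀`, and `[K : ℚ] = 2 dim A`, there EXIST `w₀, c₀, a, β, e` with the printed identity
  `c₀ Q_{θ₂}((x a) · w₀, (y a) · w₀) = σ(e · Tr_{k ⊗ K/k}(x (1 ⊗ β) ȳ))` for all `x, y`.

HONEST SCOPE.  Theorems only; no named fact.  Nothing here constructs `H_1^{dR}(A_μ/E)` or touches any END display; HC_CM is NOT proved.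

References: [Liu2021] Def. 4.5 (2) fourth bullet (TeX l. 1957); [Shimura1998] G. Shimura, *Abelian Varieties with Complex
Multiplication and Modular Functions* (1998), §5.1 Prop. 3 (the commutant of `F`; `H¹` free of rank one), §5.2;
[VoisinHodgeI2002] C. Voisin, *Hodge Theory and Complex Algebraic Geometry I*, §7.1.1 (`H^k(X, ℚ) ⊗ ℂ = H^k(X, ℂ)`),
Thm. 6.25 (hard Lefschetz); [HatcherAT2002] A. Hatcher, *Algebraic Topology*, §3.3 Prop. 3.38 (Poincaré duality).
-/

set_option autoImplicit false

noncomputable section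

open scoped TensorProduct NumberField ComplexConjugate
open CategoryTheory NumberField
open Literature.AlgebraicGeometry.Motives Literature.AlgebraicGeometry.HodgeTheory
open Literature.AlgebraicGeometry.ComplexMultiplication
open Literature.NumberTheory.ComplexMultiplication
open Literature.NumberTheory.GaloisRepresentations
open Literature.AlgebraicTopology.SingularHomology
open Literature.AlgebraicGeometry.Milne1999 (eq_zero_of_forall_polarizationPairingOne_eq_zero_of_hasHardLefschetzProperty)

namespace Literature.NumberTheory.Automorphic.Liu2021.Def45

/-! ## §1 The Betti orbit is admissible -/

section BettiOrbit

variable {k : Type} [Field k] [NumberField k] [Algebra k ℂ] {K : Type} [Field K] [NumberField K]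

/-- Hard Lefschetz for a class with a non-zero real Kähler multiple (clause (b) of `IsPolarisationClass`): Voisin I
Thm. 6.25 for the Kähler class (tree `IsKaehlerClass.hasHardLefschetzProperty` with hodge.S14 discharged by
`Motives.hasHardLefschetzProperty_kaehlerClass_holds`) and invariance under non-zero scalars. [cite: VoisinHodgeI2002, Thm. 6.25 and Rem. 6.27] -/
theorem hasHardLefschetzProperty_of_isKaehlerClass_real_smul {B : AbelianVariety ℂ} {h : complexBetti B.X 2} {s : ℝ}
    (hs : s ≠ 0) (hK : IsKaehlerClass B.dim B.X ((s : ℂ) • h)) :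
    Literature.Geometry.Kaehler.HasHardLefschetzProperty h B.dim := by
  have hX : IsSmoothProjective B.dim B.X := AbelianVariety.isSmoothProjective_holds (A := B)
  have h1 := HasHardLefschetzProperty.smul
    (hK.hasHardLefschetzProperty hX fun _ =>
      Literature.AlgebraicGeometry.Motives.hasHardLefschetzProperty_kaehlerClass_holds)
    (inv_ne_zero (Complex.ofReal_ne_zero.2 hs))
  rwa [smul_smul, inv_mul_cancel₀ (Complex.ofReal_ne_zero.2 hs), one_smul] at h1

/-- **The Betti orbit is admissible** ([Liu2021] Def. 4.5 (2) bullet 4, READING P-R2 of `Def45RMuForm` — non-vacuity of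
the antecedent of `Def45.IsRMuNormalisable`).  For `A/k`, `i : K → End⁰(A)` with `[K : ℚ] = 2 dim A` and a class `θ₂`
with `IsPolarisationClass τ₀ A i θ₂`, there are `w₀ ∈ H¹(A_ℂ(ℂ); ℂ)` and a functional `c₀` on `H^{2+2(dim-1)}(A_ℂ(ℂ); ℂ)`
with (R) `c₀ Q_{θ₂}(x · w₀, y · w₀) ∈ σ(k)` for all `x, y ∈ k ⊗_ℚ K` and (P) `x · w₀ ⊥ (k ⊗ K) · w₀` only for `x = 0`:
`w₀ = v₀ ⊗ 1` for a rational `v₀ ≠ 0` (so `K · v₀ = H¹(A_ℂ(ℂ); ℚ)`, [Shimura1998] §5.1 Prop. 3), `c₀` the coordinate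
along a rational generator of the top-degree line. [cite: Liu2021, Def. 4.5 (2) fourth bullet (TeX l. 1957)]
[cite: Shimura1998, §5.1 Proposition 3 and §5.2] [cite: VoisinHodgeI2002, §7.1.1 and Thm. 6.25] -/
theorem exists_admissible_orbit (τ₀ : K →+* ℂ) (A : AbelianVariety k) (i : K →+* A.endAlgebra)
    (hdim : Module.finrank ℚ K = 2 * A.dim) {θ₂ : bettiCohomology (A.baseChange ℂ).X 2}
    (hθ : IsPolarisationClass τ₀ A i θ₂) :
    ∃ (w₀ : complexBetti (A.baseChange ℂ).X 1)
      (c₀ : complexBetti (A.baseChange ℂ).X (2 + 2 * ((A.baseChange ℂ).dim - 1)) →ₗ[ℂ] ℂ),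
      (∀ x y : k ⊗[ℚ] K,
        c₀ (polarizationPairingOne (A.baseChange ℂ).X (ofRatClass (ComplexPoints (A.baseChange ℂ).X) 2 θ₂)
            ((A.baseChange ℂ).dim - 1) (actL A i x w₀) (actL A i y w₀)) ∈ Set.range (algebraMap k ℂ)) ∧
      (∀ x : k ⊗[ℚ] K,
        (∀ y : k ⊗[ℚ] K,
          c₀ (polarizationPairingOne (A.baseChange ℂ).X (ofRatClass (ComplexPoints (A.baseChange ℂ).X) 2 θ₂)
              ((A.baseChange ℂ).dim - 1) (actL A i x w₀) (actL A i y w₀)) = 0) → x = 0) := by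
  classical
  -- notation: the complex fibre `B = A ⊗_k ℂ`, the rational action `ψ` of `K` on `H¹(B(ℂ); ℚ)`
  have hX : IsSmoothProjective (A.baseChange ℂ).dim (A.baseChange ℂ).X := AbelianVariety.isSmoothProjective_holds (A := A.baseChange ℂ)
  set φ : K →+* (A.baseChange ℂ).endAlgebra := (AbelianVariety.endAlgebraBaseChange ℂ A).toRingHom.comp i with hφ_def
  set Q := polarizationPairingOne (A.baseChange ℂ).X (ofRatClass (ComplexPoints (A.baseChange ℂ).X) 2 θ₂) ((A.baseChange ℂ).dim - 1) with hQ_def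
  set b := Module.finBasis ℚ K with hb_def
  set bL := Algebra.TensorProduct.basis k b with hbL_def
  set ψ := hOneAlgHom φ with hψ_def
  -- dimensions
  have hBdim : (A.baseChange ℂ).dim = A.dim := AbelianVariety.dim_baseChange (A := A) (L := ℂ)
  haveI : Module.Finite ℚ (bettiCohomology (A.baseChange ℂ).X 1) := finite_bettiCohomology_one (A.baseChange ℂ)
  have hfin : Module.finrank ℚ (bettiCohomology (A.baseChange ℂ).X 1) = Module.finrank ℚ K := by
    rw [finrank_bettiCohomology_one, hBdim, hdim]
  have hKpos : 0 < Module.finrank ℚ K := Module.finrank_pos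
  have hd1 : 1 ≤ (A.baseChange ℂ).dim := by rw [hBdim]; omega
  -- a non-zero rational class `v₀` and the orbit map `m ↦ ψ m v₀`, bijective `K → H¹(B(ℂ); ℚ)`
  obtain ⟨v₀, hv₀⟩ : ∃ v : bettiCohomology (A.baseChange ℂ).X 1, v ≠ 0 :=
    (Module.finrank_pos_iff_exists_ne_zero (R := ℚ)).1 (hfin ▸ hKpos)
  let orb : K →ₗ[ℚ] bettiCohomology (A.baseChange ℂ).X 1 := (LinearMap.applyₗ v₀).comp ψ.toLinearMap
  have horb_apply : ∀ m, orb m = ψ m v₀ := fun _ => rfl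
  have horb_inj : Function.Injective orb := by
    intro m m' hmm'
    by_contra hne
    apply hv₀
    have h0 : ψ (m - m') v₀ = 0 := by rw [map_sub, LinearMap.sub_apply, ← horb_apply, ← horb_apply, hmm', sub_self]
    calc v₀ = ψ ((m - m')⁻¹ * (m - m')) v₀ := by rw [inv_mul_cancel₀ (sub_ne_zero.2 hne), map_one, Module.End.one_apply]
      _ = 0 := by rw [map_mul, Module.End.mul_apply, h0, map_zero]
  have horb_surj : Function.Surjective orb :=
    (LinearMap.injective_iff_surjective_of_finrank_eq_finrank hfin.symm).1 horb_inj
  -- the comparison `β` and the Betti vector `w₀ = v₀ ⊗ 1`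
  have hβ : ∀ v : bettiCohomology (A.baseChange ℂ).X 1, βA (A.baseChange ℂ) (1 ⊗ₜ[ℚ] v) = ofRatClass (ComplexPoints (A.baseChange ℂ).X) 1 v := fun v => by
    rw [βA, ofRatClassBaseChangeEquiv_apply, ofRatClassBaseChange_tmul, one_smul]
  set w₀ : complexBetti (A.baseChange ℂ).X 1 := ofRatClass (ComplexPoints (A.baseChange ℂ).X) 1 v₀ with hw₀_def
  have hact : ∀ m : K, complexAction φ m w₀ = ofRatClass (ComplexPoints (A.baseChange ℂ).X) 1 (ψ m v₀) := fun m => by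
    rw [hw₀_def, ← hβ, complexAction_βA, LinearMap.baseChange_tmul, hβ]
  -- the rational basis `u_j = ψ(b_j) v₀` of `H¹(B(ℂ); ℚ)` and the expansion of `x · w₀`
  set u : Fin (Module.finrank ℚ K) → bettiCohomology (A.baseChange ℂ).X 1 := fun j => ψ (b j) v₀ with hu_def
  have hactL : ∀ x : k ⊗[ℚ] K,
      actL A i x w₀ = ∑ j, algebraMap k ℂ (bL.repr x j) • ofRatClass (ComplexPoints (A.baseChange ℂ).X) 1 (u j) := fun x => by
    simp only [actL, ← hφ_def, ← hb_def, ← hbL_def, LinearMap.sum_apply, LinearMap.smul_apply, hact, hu_def]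
  -- the line `H^{2+2(dim-1)}` = `H^{2 dim}`: a rational generator `ω₀` and its coordinate `c₀`
  have h1 : Module.finrank ℂ (complexBetti (A.baseChange ℂ).X (2 + 2 * ((A.baseChange ℂ).dim - 1))) = 1 := by
    haveI := pathConnectedSpace_complexPoints hX
    change Module.finrank ℂ (singularCohomology ℂ ℂ (ComplexPoints (A.baseChange ℂ).X) (2 + 2 * ((A.baseChange ℂ).dim - 1))) = 1
    rw [ComplexPoints.finrank_singularCohomology_eq_of_add_eq ℂ hX
      (show (2 + 2 * ((A.baseChange ℂ).dim - 1)) + 0 = 2 * (A.baseChange ℂ).dim by omega),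
      (singularCohomologyZeroEquiv ℂ ℂ (ComplexPoints (A.baseChange ℂ).X)).finrank_eq, Module.finrank_self]
  obtain ⟨ω₀, hω₀, hω₀0⟩ : ∃ ω : complexBetti (A.baseChange ℂ).X (2 + 2 * ((A.baseChange ℂ).dim - 1)), IsRationalClass ω ∧ ω ≠ 0 := by
    by_contra hne
    push Not at hne
    have hspan := span_isRationalClass_eq_top_of_isSmoothProjective_holds (A.baseChange ℂ).dim (A.baseChange ℂ).X hX (2 + 2 * ((A.baseChange ℂ).dim - 1))
    have hbot : Submodule.span ℂ {c : complexBetti (A.baseChange ℂ).X (2 + 2 * ((A.baseChange ℂ).dim - 1)) | IsRationalClass c} = ⊥ := by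
      rw [Submodule.span_eq_bot]
      exact fun c hc => hne c hc
    have h0 : Module.finrank ℂ (complexBetti (A.baseChange ℂ).X (2 + 2 * ((A.baseChange ℂ).dim - 1))) = 0 := by
      rw [← finrank_top, ← hspan, hbot, finrank_bot]
    omega
  set c₀ := lineCoord ω₀ hω₀0 h1 with hc₀_def
  -- the rational Gram values `q j l` with `c₀ Q(u_j ⊗ 1, u_l ⊗ 1) = q j l`
  have hθrat : IsRationalClass (ofRatClass (ComplexPoints (A.baseChange ℂ).X) 2 θ₂) := isRationalClass_ofRatClass θ₂
  have hq : ∀ v v' : bettiCohomology (A.baseChange ℂ).X 1, ∃ q : ℚ,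
      c₀ (Q (ofRatClass (ComplexPoints (A.baseChange ℂ).X) 1 v) (ofRatClass (ComplexPoints (A.baseChange ℂ).X) 1 v')) = (q : ℂ) := fun v v' =>
    exists_lineCoord_eq_ratCast h1 hω₀ hω₀0 (isRationalClass_polarizationPairingOne_ofRatClass hθrat _ v v')
  choose q hq' using hq
  -- (R): bilinear expansion of the Gram value on the orbit — a sum of products of elements of `σ(k)`
  have hgram : ∀ x y : k ⊗[ℚ] K, c₀ (Q (actL A i x w₀) (actL A i y w₀)) ∈ Set.range (algebraMap k ℂ) := by
    intro x y
    have hS : ∀ z : ℂ, z ∈ Set.range (algebraMap k ℂ) ↔ z ∈ (algebraMap k ℂ).range := fun z => Iff.rfl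
    have hqmem : ∀ v v', (q v v' : ℂ) ∈ (algebraMap k ℂ).range := fun v v' =>
      RingHom.mem_range.2 ⟨(q v v' : k), by rw [map_ratCast]⟩
    rw [hS, hactL, hactL]
    simp only [map_sum, LinearMap.sum_apply, map_smul, LinearMap.smul_apply, smul_eq_mul, hq']
    exact Subring.sum_mem _ fun j _ => Subring.mul_mem _ (RingHom.mem_range.2 ⟨_, rfl⟩)
      (Subring.sum_mem _ fun l _ => Subring.mul_mem _ (RingHom.mem_range.2 ⟨_, rfl⟩) (hqmem _ _))
  refine ⟨w₀, c₀, hgram, fun x hx => ?_⟩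
  -- (P): `x · w₀` pairs to zero with every rational class …
  have hrat : ∀ v : bettiCohomology (A.baseChange ℂ).X 1, c₀ (Q (actL A i x w₀) (ofRatClass (ComplexPoints (A.baseChange ℂ).X) 1 v)) = 0 := by
    intro v
    obtain ⟨m, hm⟩ := horb_surj v
    rw [horb_apply] at hm
    rw [← hm, ← hact, ← actL_one_tmul A i m]
    exact hx _
  -- … hence with all of `H¹(B(ℂ); ℂ)` (through `β`), …
  have hall : ∀ z : complexBetti (A.baseChange ℂ).X 1, c₀ (Q (actL A i x w₀) z) = 0 := by
    intro z
    obtain ⟨t, rfl⟩ := (βA (A.baseChange ℂ)).surjective z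
    induction t using TensorProduct.induction_on with
    | zero => rw [map_zero, map_zero, map_zero]
    | tmul c v => rw [βA, ofRatClassBaseChangeEquiv_apply, ofRatClassBaseChange_tmul, map_smul, map_smul, hrat, smul_zero]
    | add t₁ t₂ h₁ h₂ => rw [map_add, map_add, map_add, h₁, h₂, add_zero]
  -- … so `Q(x · w₀, ·) = 0` (`c₀` is injective on the line) and `x · w₀ = 0` by hard Lefschetz
  have hQ0 : ∀ z : complexBetti (A.baseChange ℂ).X 1, Q (actL A i x w₀) z = 0 := fun z => by
    rw [← lineCoord_smul_self ω₀ hω₀0 h1 (Q (actL A i x w₀) z), ← hc₀_def, hall z, zero_smul]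
  obtain ⟨s, hs, hK⟩ := hθ.2.1
  have hxw : actL A i x w₀ = 0 :=
    eq_zero_of_forall_polarizationPairingOne_eq_zero_of_hasHardLefschetzProperty hd1
      (hasHardLefschetzProperty_of_isKaehlerClass_real_smul hs hK) hQ0
  -- the orbit map is injective: `β` carries the `ℂ`-basis `1 ⊗ u_j` onto `u_j ⊗ 1`
  have hub : LinearIndependent ℚ u := by
    have hcomp : u = orb ∘ b := funext fun j => (horb_apply (b j)).symm
    rw [hcomp]
    exact b.linearIndependent.map' orb (LinearMap.ker_eq_bot.2 horb_inj)
  have hsp : ⊤ ≤ Submodule.span ℚ (Set.range u) := by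
    rw [top_le_iff]
    have hru : Set.range u = orb '' Set.range b := by
      ext v
      constructor
      · rintro ⟨j, rfl⟩
        exact ⟨b j, ⟨j, rfl⟩, (horb_apply (b j)).trans rfl⟩
      · rintro ⟨_, ⟨j, rfl⟩, rfl⟩
        exact ⟨j, rfl⟩
    rw [hru, Submodule.span_image, b.span_eq, Submodule.map_top, LinearMap.range_eq_top.2 horb_surj]
  have huB : LinearIndependent ℂ fun j => (1 : ℂ) ⊗ₜ[ℚ] u j := by
    have h := (Algebra.TensorProduct.basis ℂ (Module.Basis.mk hub hsp)).linearIndependent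
    have heq : ⇑(Algebra.TensorProduct.basis ℂ (Module.Basis.mk hub hsp)) = fun j => (1 : ℂ) ⊗ₜ[ℚ] u j :=
      funext fun j => by rw [Algebra.TensorProduct.basis_apply, Module.Basis.mk_apply]
    rwa [heq] at h
  have hli : LinearIndependent ℂ fun j => ofRatClass (ComplexPoints (A.baseChange ℂ).X) 1 (u j) := by
    have h2 := huB.map' (βA (A.baseChange ℂ)).toLinearMap (LinearEquiv.ker (βA (A.baseChange ℂ)))
    have heq : ((βA (A.baseChange ℂ)).toLinearMap ∘ fun j => (1 : ℂ) ⊗ₜ[ℚ] u j) =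
        fun j => ofRatClass (ComplexPoints (A.baseChange ℂ).X) 1 (u j) := funext fun j => hβ (u j)
    rwa [heq] at h2
  rw [hactL] at hxw
  have hcoef : ∀ j, algebraMap k ℂ (bL.repr x j) = 0 := Fintype.linearIndependent_iff.1 hli _ hxw
  have hx0 : ∀ j, bL.repr x j = 0 := fun j => (algebraMap k ℂ).injective (by rw [hcoef j, map_zero])
  apply bL.repr.injective
  ext j
  rw [hx0 j, map_zero, Finsupp.zero_apply]

end BettiOrbit

/-! ## §2 Hence `IsRMuNormalisable` has content: the printed identity is ATTAINED on some orbit -/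

section Content

variable {k : Type} [Field k] [NumberField k] [Algebra k ℂ] {K : Type} [Field K] [NumberField K]

/-- **`IsRMuNormalisable` is not vacuous**: if `IsRMuNormalisable τ₀ A i θ₂` holds at a CM pair (`[K : ℚ] = 2 dim A`,
`θ₂` with bullet 3) then for every `ρ` inducing complex conjugation along `τ₀` there EXIST `w₀`, `c₀`, a unit `a`,
`β ∈ K` and `e ≠ 0` with the printed identity `c₀ Q_{θ₂}((x a) · w₀, (y a) · w₀) = σ(e · Tr_{k ⊗ K/k}(x (1 ⊗ β) ȳ))` for all
`x, y` — apply the predicate to the admissible Betti orbit of §1. [cite: Liu2021, Def. 4.5 (2) fourth bullet (TeX l. 1957)] -/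
theorem IsRMuNormalisable.exists_normalised {τ₀ : K →+* ℂ} {A : AbelianVariety k} {i : K →+* A.endAlgebra}
    {θ₂ : bettiCohomology (A.baseChange ℂ).X 2} (h : IsRMuNormalisable τ₀ A i θ₂)
    (hdim : Module.finrank ℚ K = 2 * A.dim) (hθ : IsPolarisationClass τ₀ A i θ₂)
    (ρ : K →+* K) (hρ : ∀ x, τ₀ (ρ x) = conj (τ₀ x)) :
    ∃ (w₀ : complexBetti (A.baseChange ℂ).X 1)
      (c₀ : complexBetti (A.baseChange ℂ).X (2 + 2 * ((A.baseChange ℂ).dim - 1)) →ₗ[ℂ] ℂ)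
      (a : k ⊗[ℚ] K) (β : K) (e : k), IsUnit a ∧ e ≠ 0 ∧
      ∀ x y : k ⊗[ℚ] K,
        c₀ (polarizationPairingOne (A.baseChange ℂ).X (ofRatClass (ComplexPoints (A.baseChange ℂ).X) 2 θ₂)
            ((A.baseChange ℂ).dim - 1) (actL A i (x * a) w₀) (actL A i (y * a) w₀)) =
          algebraMap k ℂ (e * Algebra.trace k (k ⊗[ℚ] K)
            (x * ((1 : k) ⊗ₜ[ℚ] β) * Algebra.TensorProduct.map (AlgHom.id k k) ρ.toRatAlgHom y)) := by
  obtain ⟨w₀, c₀, hR, hP⟩ := exists_admissible_orbit τ₀ A i hdim hθ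
  obtain ⟨a, β, e, ha, he, hid⟩ := h ρ hρ w₀ c₀ hR hP
  exact ⟨w₀, c₀, a, β, e, ha, he, hid⟩

end Content


end Literature.NumberTheory.Automorphic.Liu2021.Def45

end
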